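import Literature.MathematicalPhysics.QuantumFieldTheory.BalabanImbrieJaffe1984to88.BIJ88Ineq246Lattice
import Literature.MathematicalPhysics.QuantumFieldTheory.BalabanImbrieJaffe1984to88.BIJ88Decay241SmallFieldTorus

/-!
# `BalabanImbrieJaffe1984to88.BIJ88Eq242HiggsCovarianceTorus` — T. Bałaban, J. Imbrie, A. Jaffe, *Effective action and cluster properties of
the abelian Higgs model*, Commun. Math. Phys. **114** (1988) 257–315 [BalabanImbrieJaffe1988], §2 pp. 264–265 [PDF 8–9], (2.41)–(2.47):
**THE RANDOM WALK EXPANSION (2.42), ITS RESUMMATION (2.45) AND THE BOUNDS (2.41)/(2.43)/(2.46)/(2.47) FOR THE MODEL'S ACTUAL COVARIANCE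
`C^{(k)}_Λ(u) = [(Δ + κP(u))|_Λ]^{−1}` ON THE TORUS** — p13's `ℤ^d` walk machinery of [6] = [Balaban1983RegularityDecay] Sect. 5
(`BIJ88Eq242Lattice` / `BIJ88Ineq246Lattice`: every finite `Λ ⊂ ℤ^d`, every operator on `L²(Λ; ℝ^N)` with [6] (5.6)) INSTANTIATED at the realified,
charted torus operator, whose (5.6) is PROVED here from the (2.38)-shape lower bound + the block Poincaré step (p. 264 *"by (2.38), C^{(k)}_Λ(u)^{−1}
is bounded below"*) and the (2.36)-shape kernel bound.  p13's headers: *«the identification of `A` with the print's `Δ_{k,loc}(u) + aL^{−2}Q(u)*Q(u)`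
(whose (5.6) is (2.38) + [6] Lemma 2.1) is NOT made here»* — it is made here.

statement-level skeleton of published theorems with citation tags; proofs where landed; nothing here is a claim about the Yang–Mills mass gap

PDF held: `paper:balaban1988-cmp114-bij-abelian-higgs-effective-action` (journal page = PDF page + 256; pp. 264–265 = PDF 8–9 re-read this session,
`lit read … --pages 8-9`).

CITATION HEADER (lean-in-tree rule).  lit-balaban cell (HOME `run/shared/lean/pub/lit-balaban/`), Phase 2, proof seat **p31 gen 23** (unit
`lit-balaban-p31`, literature-prover-lit-balaban-p31-g23-0), free-target protocol G.5-34(d), TAKING #1 line HOME/STATUS.md 2026-08-23T08:50Z (window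
20 min; stem check `242|246|247` = p13/p36/p02 files only; cc r18, p13).  Rows of `HOME/lit-balaban-r18/ROWS-C2.md` served (LOCATED MEMBERS «for the
model's actual `C^{(k)}_Λ(u)` on the torus», cells only; heads unchanged; decls of record stay p13's / p02's / p36's; owner r18): **C2.Eq2.42**,
**C2.Eq2.43**, **C2.Eq2.45**, **C2.Eq2.46**, **C2.Eq2.47**, and **C2.Eq2.41** (the printed walk route), **C2.Eq2.39/2.40** (the Dirichlet restriction
charted).  Files USED BY NAME, nothing restated: p13 `BIJ88Eq242Lattice` (`eq242_lattice`, `eq245_lattice`, `latticeCw`), `BIJ88Ineq246Lattice`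
(`abs_inv_lattice_le`, `abs_cLoc_lattice_le`, `abs_cX_lattice_le`, `ineq246_lattice`, `abs_cLoc_sub_inv_le`, `close247_lattice`, `ldist`, `sdist`,
`cubeOf`, `touch`, `Cubes`, `K0`, `thetaW`), `BIJ88RandomWalk242` (`Walk`, `Eq242`, `cLoc`, `cX`, `memX`), `B4Sect5CubeBounds` (`labels`, `kR`,
`thetaConst`, `InBox`), `B4.Hyp56` / `B4.Idx`; p31 gen 18 `BIJ88Eq240FlatTorus` (`realify`, `compress`, `op240`, `pOp`, `c240`, `realify_isSymm`),
gen 19 `BIJ88Decay241FlatTorus` (`abs_realify_apply_le`, `realify_inv`, `realify_apply_fst/snd`, `isUnit_of_re_coercive`, `coercive_realify`,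
`pOp_apply_of_ne`, `norm_pOp_apply_le`), gen 19 `BIJ88Decay241SmallFieldTorus` (`re_coercive_compress_smallField`, `isUnit_compress_op240_smallField`); r18/p02 typed rows
`BIJ88Sect2Statements.Eq245` / `Ineq246` / `Close`; p38 `B5Ineq137Torus.T`; pv09 `B4Sect5Torus.ccoord`; `B4TorusKernel.MultiPeriod.circAbs_le_abs`.

## The print (verbatim, pp. 264–265 [PDF 8–9])

*"We define C^{(k)}_Λ(u) = [(Δ_{k,loc}(u) + aL^{−2}Q(u)*Q(u)|_Λ]^{−1}. (2.40) This is of course a nonlocal operator, but by (2.38), C^{(k)}_Λ(u)^{−1} is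
bounded below and a random walk expansion as in [6] can be used to prove that |C^{(k)}_Λ(u; x₁, x₂)| ≦ ce^{−c|x₁−x₂|}. (2.41) We shall actually use
a convenient resummation of this expansion. The basic expansion has the form C^{(k)}_Λ(u; x₁, x₂) = Σ_ω C^{(k)}_{Λ,ω}(u, x₁, x₂), (2.42) where ω is
a walk on a lattice of spacing M = O(1). We define the localized form of C^{(k)}_Λ(u) to be C^{(k)}_{Λ,loc}(u; x₁, x₂) = Σ′_ω C^{(k)}_{Λ,ω}(x₁, x₂),
(2.43) where the prime indicates that only ω remaining within ¼r(e_k) of x₁, x₂ are included. Let X be a connected union of r(e_k)-cubes … (2.44)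
… Then we define C^{(k)}_Λ(u) = C^{(k)}_{Λ,loc}(u) + Σ_X C^{(k)}_{Λ,X}(u), (2.45) and the convergence and locality properties of the random walk
expansion imply the following facts about these operators. The local part … is bounded as in (2.41). The operator C^{(k)}_{Λ,X}(u) depends only on
u in X. It vanishes unless both arguments are in X, and is estimated as follows: |C^{(k)}_{Λ,X}(u; x₁, x₂)| ≦ e^{−cr(e_k)|X|}. (2.46) Here and
elsewhere, |X| refers to the number of r(e_k)-cubes in X, not the volume of X. This estimate can be summed over all connected sets X to show that
|C^{(k)}_{Λ,loc}(u; x₁, x₂) − C^{(k)}_Λ(u; x₁, x₂)| ≦ e^{−cr(e_k)}e^{−c|x₁−x₂|}. (2.47)"*.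

## What is proved (0 `sorry`; standard axioms)

* §1 THE CHART `T^{(k)} → ℤ^d` (`chart x = (x_μ.val)_μ`, `chart_injective`), the charted region `chartSet Λ = Λ′ ⊂ ℤ^d`, `chartEquiv : Λ ≃ Λ′`,
  `idxEquiv : Λ × Fin 2 ≃ B4.Idx Λ′ 2`; the chart sup-distance `cdist` with `abs_sub_le_cdist`, `cdist_le_of_forall`, **`T_le_cdist`** (the torus
  distance is dominated by the chart distance) and **`cdist_le_of_blkIter_eq`** (two sites of one `L`-block are at chart distance `≤ L − 1`).
* §2 `reOp Λ H` = gen 18's `realify (compress Λ H)` re-indexed by `B4.Idx Λ′ 2`; `reOp_apply`, `reOp_inv`, **`reOp_inv_apply`** (its inverse is the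
  charted `realify C`, `C = (H|_Λ)^{−1}`), `reOp_inv_apply_re/im` (the `(Re,Re)`/`(Im,Re)` entries are `Re C(x₁,x₂)`/`Im C(x₁,x₂)`), `reOp_mulVec`.
* §3 **`hyp56_reOp`**: [6] (5.6) `B4.Hyp56 Λ′ (reOp Λ H) γ c₀ δ₀` from: `H|_Λ` Hermitian, `γΣ‖v‖² ≤ Re vᴴ(H|_Λ)v`, `‖H(x₁,x₂)‖ ≤ c₀e^{−δ₀|x₁−x₂|_chart}`
  on `Λ × Λ`.
* §4 **`hyp56_op240_smallField`**: (5.6) for `(Δ + κP(u))|_Λ` at a small field — `γ₀ = c₀(γ,κ)(1−σ) − E` from the (2.38)-shape bound + block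
  Poincaré with smallness terms (`re_coercive_compress_smallField`), `c₀ = c_Δ + κL^{−2d}e^{δ₀(L−1)}` from the (2.36)-shape bound + one-block range of
  `P(u)` (`norm_op240_apply_le_cdist`); invertibility is gen 19's `isUnit_compress_op240_smallField` BY NAME.
* §5 FOR ANY `H` WITH (5.6) OF ITS CHARTED OPERATOR (p13 BY NAME): **`eq242_realify_inv`** (`Eq242 (realify C) (C_ω ∘ idxEquiv)`), **`hasSum_walkTerms_inv`**
  ((2.42) in `ℂ`: `C(x₁,x₂) = Σ_ω C^ℂ_ω(x₁,x₂)`), **`eq245_realify_inv`** ((2.45), `Eq245`), **`abs_realify_inv_le_walk`** / **`norm_inv_apply_le_walk`**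
  ((2.41) by the walk route, chart / torus distance), **`abs_cLoc_le_walk`** ((2.43)), **`abs_cX_le_walk`** / **`ineq246_walk`** ((2.46), two-constant
  form / typed `Ineq246`), **`abs_cLoc_sub_realify_inv_le`** / **`close247_walk`** ((2.47), two-constant form / typed `Close`).
* §6 THE SMALL-FIELD MEMBERS (§4 + §5): **`eq242_smallField`**, **`eq245_smallField`**, **`decay241_walk_smallField`**, **`ineq246_smallField`**,
  **`close247_smallField`** — (2.42)/(2.45)/(2.41)/(2.46)/(2.47) for `C^{(k)}_Λ(u) = [(Δ + κP(u))|_Λ]^{−1}` under exactly gen 19's `decay241_smallField`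
  hypotheses (small bond field, Hermitian `Δ` with the (2.38)-shape bound on the `Λ`-supported fields, `E < c₀(γ,κ)(1−σ)`) with the (2.36)-shape kernel
  bound read in the CHART distance, and p13's cube-size conditions.

HONEST SCOPE / DIVERGENCE.  (i) REAL COORDINATES: p13's rows are typed for real kernels (`Eq242`, `Eq245`, `Ineq246`, `Close` over `ℝ`); the members
here are stated for the entries of gen 18's realification `realify C` indexed by `Λ × {Re, Im}` — `realify C ((x₁,Re),(x₂,Re)) = Re C(x₁,x₂)`,
`((x₁,Im),(x₂,Re)) = Im C(x₁,x₂)` — plus the complex `HasSum` form of (2.42) and the complex norm form of (2.41).  (ii) CHART DISTANCE: the (2.36)-shape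
input and the decay conclusions use the sup-distance of the integer representatives `x_μ.val ∈ [0, N)` (p13's `dist`/`sdist` on `ℤ^d`); it dominates
the torus distance (`T_le_cdist`, so the (2.41) conclusion is also stated in the torus distance) and EQUALS it for pairs inside a box of side `≤ N/2`
(the concrete instance for gen 15's `Δ_{k,loc}(u)` with the printed torus data, where `Λ` sits inside the reference box, is the successor file; here
the kernel hypothesis is displayed in the chart distance, as gen 19 displays it in the torus distance).  (iii) WALK DATA = p13's: cubes of `M` lattice
units on the charted `Λ` ([6] (5.11)), `r(e_k)`-cubes of `s` labels (`cubeOf M s`), touching adjacency, label distance `ldist`, `ρ` (print `¼r(e_k)`: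
`ρ = s/4`), constants `K_R`, `Θ₁`, `θ_W`, `K₀` at `N = 2`; distances in LABEL units.  (iv) Small bond field `u` on `T^{(k)}` (gen 19's (T, δ, σ)
conditions); `Δ` Hermitian.  (v) METHOD for (2.41): here the printed walk route (summing (2.42)); gen 19's `decay241_smallField` is the finite
Combes–Thomas twin with other constants.  (vi) The u-locality clauses (*"depends only on u in X"*) are p13's `BIJ88Locality246Lattice` for the abstract
operator and are not instantiated here (they need the locality of `Δ_{k,loc}(u)` in `u`, a successor item).
Imports: p13 `BIJ88Ineq246Lattice` (→ `BIJ88Eq242Lattice`, `BIJ88RandomWalk242`, `B4Sect5CubeBounds`), gen 19 `BIJ88Decay241SmallFieldTorus`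
(→ `BIJ88Decay241FlatTorus`, `BIJ88Eq240FlatTorus`).  Literature + Mathlib only.  Unit `lit-balaban-p31` (literature-prover-lit-balaban-p31-g23-0),
2026-08-23.  NOT summit progress.
-/

open scoped BigOperators Matrix ComplexConjugate
open Finset Matrix

namespace Literature.MathematicalPhysics.QuantumFieldTheory.BalabanImbrieJaffe1984to88.BIJ88Eq242HiggsCovarianceTorus

open Literature.MathematicalPhysics.QuantumFieldTheory.Balaban1983to89
open BIJ88Sect3Statements (U1 toC)
open BIJ85BlockAveragesTorus BIJ85BlockAveragesTorusK
open BIJ88Eq240FlatTorus (realify cplx compress op240 pOp c240 realify_isSymm dotProduct_realify_mulVec op240_isHermitian)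
open BIJ88Decay241FlatTorus (abs_realify_apply_le realify_inv isUnit_of_re_coercive coercive_realify realify_apply_fst realify_apply_snd
  pOp_apply_of_ne norm_pOp_apply_le)
open BIJ88Decay241SmallFieldTorus (re_coercive_compress_smallField isUnit_compress_op240_smallField)
open BIJ88RandomWalk242 BIJ88Eq242Lattice BIJ88Ineq246Lattice B4Sect5CubeBounds
open B4TorusKernel.MultiPeriod (circAbs circAbs_le_abs)

noncomputable section

variable {P : Params} {j : ℕ}

/-! ## §1 The chart `T^{(k)} → ℤ^d` (integer representatives of the coordinates) and its sup-distance -/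

section Chart

/-- **The chart of the torus `T^{(k)}` into `ℤ^d`**: a site `x = (x_μ)_μ`, `x_μ ∈ ℤ/N`, is sent to its integer representatives
`(x_μ.val)_μ ∈ [0, N)^d ⊂ ℤ^d` — the carrier `ℤ^d` of [6] Sect. 5 on which (2.42) is built ("a walk on a lattice of spacing M").
[cite: BalabanImbrieJaffe1988, (2.42) p.264] -/
def chart (x : Balaban1983to89.Site P j) : Fin P.d → ℤ := fun μ => ((x μ).val : ℤ)

/-- the chart is injective. [cite: BalabanImbrieJaffe1988, (2.42) p.264] -/
theorem chart_injective : Function.Injective (chart (P := P) (j := j)) := by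
  intro x y h
  funext μ
  have hμ := congrFun h μ
  simp only [chart, Nat.cast_inj] at hμ
  exact ZMod.val_injective _ hμ

/-- the chart as an embedding. [cite: BalabanImbrieJaffe1988, (2.42) p.264] -/
def chartEmb : Balaban1983to89.Site P j ↪ (Fin P.d → ℤ) := ⟨chart, chart_injective⟩

/-- **the charted region `Λ′ ⊂ ℤ^d`** of a region `Λ ⊆ T^{(k)}` (the finite `Λ ⊂ ℤ^d` of p13's `BIJ88Eq242Lattice`).
[cite: BalabanImbrieJaffe1988, (2.42) p.264] -/
def chartSet (Λ : Finset (Balaban1983to89.Site P j)) : Finset (Fin P.d → ℤ) := Λ.map chartEmb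

/-- the chart restricted to `Λ`, onto `Λ′`. [cite: BalabanImbrieJaffe1988, (2.42) p.264] -/
def chartPt (Λ : Finset (Balaban1983to89.Site P j)) (x : ↥Λ) : ↥(chartSet Λ) :=
  ⟨chart x.1, Finset.mem_map_of_mem chartEmb x.2⟩

/-- `Λ ≃ Λ′` along the chart. [cite: BalabanImbrieJaffe1988, (2.42) p.264] -/
def chartEquiv (Λ : Finset (Balaban1983to89.Site P j)) : ↥Λ ≃ ↥(chartSet Λ) :=
  Equiv.ofBijective (chartPt Λ)
    ⟨fun x y h => Subtype.ext (chart_injective (congrArg Subtype.val h)), fun y => by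
      obtain ⟨x, hx, hxy⟩ := Finset.mem_map.1 y.2
      exact ⟨⟨x, hx⟩, Subtype.ext hxy⟩⟩

/-- kernel: the chart equivalence on the first component is the chart. [cite: BalabanImbrieJaffe1988, (2.42) p.264] -/
@[simp] theorem coe_chartEquiv (Λ : Finset (Balaban1983to89.Site P j)) (x : ↥Λ) : ((chartEquiv Λ x : ↥(chartSet Λ)) : Fin P.d → ℤ) = chart x.1 :=
  rfl

/-- **the index equivalence** `Λ × {Re, Im} ≃ B4.Idx Λ′ 2` (two real components per charted site: p13's `L²(Λ′; ℝ²)`).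
[cite: BalabanImbrieJaffe1988, (2.42) p.264] -/
def idxEquiv (Λ : Finset (Balaban1983to89.Site P j)) : (↥Λ × Fin 2) ≃ B4.Idx (chartSet Λ) 2 :=
  (chartEquiv Λ).prodCongr (Equiv.refl (Fin 2))

/-- kernel: the site underlying `idxEquiv Λ p` is the chart of the site of `p`. [cite: BalabanImbrieJaffe1988, (2.42) p.264] -/
@[simp] theorem coe_idxEquiv_fst (Λ : Finset (Balaban1983to89.Site P j)) (p : ↥Λ × Fin 2) :
    (((idxEquiv Λ p).1 : ↥(chartSet Λ)) : Fin P.d → ℤ) = chart p.1.1 := rfl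

/-- kernel: the component of `idxEquiv Λ p` is the component of `p`. [cite: BalabanImbrieJaffe1988, (2.42) p.264] -/
@[simp] theorem idxEquiv_snd (Λ : Finset (Balaban1983to89.Site P j)) (p : ↥Λ × Fin 2) : (idxEquiv Λ p).2 = p.2 := rfl

/-- **the chart sup-distance** `|x − y|_chart = max_μ |x_μ.val − y_μ.val|` (the sup-distance of `ℤ^d` of [6] (5.6) read on the torus through
the chart; it dominates the torus distance and equals it for pairs inside a half-torus box). [cite: BalabanImbrieJaffe1988, (2.41) p.264] -/
def cdist (x y : Balaban1983to89.Site P j) : ℝ := dist (chart x) (chart y)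

/-- `cdist ≥ 0`. [cite: BalabanImbrieJaffe1988, (2.41) p.264] -/
theorem cdist_nonneg (x y : Balaban1983to89.Site P j) : 0 ≤ cdist x y := dist_nonneg

/-- `cdist` is symmetric. [cite: BalabanImbrieJaffe1988, (2.41) p.264] -/
theorem cdist_comm (x y : Balaban1983to89.Site P j) : cdist x y = cdist y x := dist_comm _ _

/-- kernel: the chart distance of the underlying sites of two indices is p13's `dist` of their charted points.
[cite: BalabanImbrieJaffe1988, (2.41) p.264] -/
theorem dist_idxEquiv (Λ : Finset (Balaban1983to89.Site P j)) (p q : ↥Λ × Fin 2) :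
    dist (((idxEquiv Λ p).1 : ↥(chartSet Λ)) : Fin P.d → ℤ) (((idxEquiv Λ q).1 : ↥(chartSet Λ)) : Fin P.d → ℤ) = cdist p.1.1 q.1.1 := rfl

/-- each coordinate difference is bounded by the chart distance. [cite: BalabanImbrieJaffe1988, (2.41) p.264] -/
theorem abs_sub_le_cdist (x y : Balaban1983to89.Site P j) (μ : Fin P.d) : |((x μ).val : ℝ) - (y μ).val| ≤ cdist x y := by
  have h := dist_le_pi_dist (chart x) (chart y) μ
  rw [Int.dist_eq] at h
  unfold cdist
  simpa [chart] using h

/-- the chart distance is bounded by a common bound of the coordinate differences. [cite: BalabanImbrieJaffe1988, (2.41) p.264] -/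
theorem cdist_le_of_forall {x y : Balaban1983to89.Site P j} {r : ℝ} (hr : 0 ≤ r) (h : ∀ μ, |((x μ).val : ℝ) - (y μ).val| ≤ r) :
    cdist x y ≤ r := by
  rw [cdist, dist_pi_le_iff hr]
  intro μ
  rw [Int.dist_eq]
  simpa [chart] using h μ

/-- **the torus distance is dominated by the chart distance**: `|x − y|_{T} ≤ |x − y|_chart` (`dist(a, Nℤ) ≤ |a|` coordinatewise).
[cite: BalabanImbrieJaffe1988, (2.41) p.264] -/
theorem T_le_cdist (x y : Balaban1983to89.Site P j) : B5Ineq137Torus.T P j x y ≤ cdist x y := by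
  have hN : 1 ≤ P.sitesPerDir j := (P.one_lt_sitesPerDir j).le
  unfold B5Ineq137Torus.T B4Sect5Torus.tdist
  obtain ⟨μ, -, hμ⟩ := Finset.exists_mem_eq_sup (univ : Finset (Fin P.d)) ⟨⟨0, P.hd⟩, mem_univ _⟩
    (B4Sect5Torus.ccoord (B5Ineq137Torus.Nv P j) (B5Ineq137Torus.toT x) (B5Ineq137Torus.toT y))
  rw [hμ]
  have hcc := B4Sect5Torus.ccoord_cast (B5Ineq137Torus.Nv_pos P j) (B5Ineq137Torus.toT x) (B5Ineq137Torus.toT y) μ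
  have hca := circAbs_le_abs hN (((x μ).val : ℤ) - ((y μ).val : ℤ))
  have h1 : ((B4Sect5Torus.ccoord (B5Ineq137Torus.Nv P j) (B5Ineq137Torus.toT x) (B5Ineq137Torus.toT y) μ : ℕ) : ℤ) ≤
      |((x μ).val : ℤ) - ((y μ).val : ℤ)| := by
    rw [hcc]; exact hca
  have h2 : ((B4Sect5Torus.ccoord (B5Ineq137Torus.Nv P j) (B5Ineq137Torus.toT x) (B5Ineq137Torus.toT y) μ : ℕ) : ℝ) ≤
      |((x μ).val : ℝ) - (y μ).val| := by
    have := (Int.cast_le (R := ℝ)).2 h1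
    push_cast at this
    exact this
  exact h2.trans (abs_sub_le_cdist x y μ)

/-- **two sites of one `L`-block are at chart distance `≤ L − 1`** (their coordinates have the same quotient by `L` in every direction; the chart
version of gen 19's `T_le_of_blkIter_eq`). [cite: BalabanImbrieJaffe1985, (2.4) p.302] -/
theorem cdist_le_of_blkIter_eq (hj : j + 1 ≤ P.m + P.K) {x x' : Balaban1983to89.Site P j} (h : blkIter 1 x = blkIter 1 x') :
    cdist x x' ≤ (P.L : ℝ) - 1 := by
  have hL : 1 ≤ P.L := P.L_pos
  have hL0 : (0 : ℝ) ≤ (P.L : ℝ) - 1 := by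
    have : (1 : ℝ) ≤ P.L := by exact_mod_cast hL
    linarith
  refine cdist_le_of_forall hL0 fun μ => ?_
  have e1 := BIJ85BlockKPoincare.val_blkIter 1 hj x μ
  have e2 := BIJ85BlockKPoincare.val_blkIter 1 hj x' μ
  have hq : (x μ).val / P.L = (x' μ).val / P.L := by
    have hh : (blkIter 1 x μ).val = (blkIter 1 x' μ).val := by rw [h]
    rwa [e1, e2, pow_one] at hh
  obtain ⟨q, r, hr, hxe⟩ : ∃ q r : ℕ, r < P.L ∧ (x μ).val = P.L * q + r :=
    ⟨_, _, Nat.mod_lt (x μ).val P.L_pos, (Nat.div_add_mod (x μ).val P.L).symm⟩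
  obtain ⟨q', r', hr', hxe'⟩ : ∃ q r : ℕ, r < P.L ∧ (x' μ).val = P.L * q + r :=
    ⟨_, _, Nat.mod_lt (x' μ).val P.L_pos, (Nat.div_add_mod (x' μ).val P.L).symm⟩
  have hqq : q = q' := by
    have a1 : (x μ).val / P.L = q := by rw [hxe, Nat.mul_add_div P.L_pos, Nat.div_eq_of_lt hr, add_zero]
    have a2 : (x' μ).val / P.L = q' := by rw [hxe', Nat.mul_add_div P.L_pos, Nat.div_eq_of_lt hr', add_zero]
    rw [← a1, ← a2]; exact hq
  subst hqq
  rw [hxe, hxe']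
  push_cast
  rw [show (P.L : ℝ) * q + r - ((P.L : ℝ) * q + r') = r - r' by ring, abs_le]
  have hr1 : (r : ℝ) ≤ (P.L : ℝ) - 1 := by
    have : r + 1 ≤ P.L := hr
    have : ((r + 1 : ℕ) : ℝ) ≤ P.L := by exact_mod_cast this
    push_cast at this; linarith
  have hr1' : (r' : ℝ) ≤ (P.L : ℝ) - 1 := by
    have : r' + 1 ≤ P.L := hr'
    have : ((r' + 1 : ℕ) : ℝ) ≤ P.L := by exact_mod_cast this
    push_cast at this; linarith
  constructor <;> linarith [(Nat.cast_nonneg r : (0 : ℝ) ≤ r), (Nat.cast_nonneg r' : (0 : ℝ) ≤ r')]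

end Chart

/-! ## §2 The charted real operator: the realification of `M|_Λ` re-indexed by `B4.Idx Λ′ 2` -/

section ReOp

/-- **The charted real operator of a complex operator `H` restricted to `Λ`**: gen 18's realification `[[Re, −Im], [Im, Re]]` of the Dirichlet
restriction `H|_Λ` (the `|_Λ` of (2.39)/(2.40)), re-indexed through the chart by p13's index type `B4.Idx Λ′ 2` — an operator on `L²(Λ′; ℝ²)`,
`Λ′ ⊂ ℤ^d`, of the kind [6] Sect. 5 treats. [cite: BalabanImbrieJaffe1988, (2.40) p.264] -/
def reOp (Λ : Finset (Balaban1983to89.Site P j)) (H : Matrix (Balaban1983to89.Site P j) (Balaban1983to89.Site P j) ℂ) :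
    Matrix (B4.Idx (chartSet Λ) 2) (B4.Idx (chartSet Λ) 2) ℝ :=
  Matrix.reindex (idxEquiv Λ) (idxEquiv Λ) (realify (compress Λ H))

variable {Λ : Finset (Balaban1983to89.Site P j)} {H : Matrix (Balaban1983to89.Site P j) (Balaban1983to89.Site P j) ℂ}

/-- kernel: the entries of the charted operator are the entries of the realification. [cite: BalabanImbrieJaffe1988, (2.40) p.264] -/
theorem reOp_apply (p q : ↥Λ × Fin 2) : reOp Λ H (idxEquiv Λ p) (idxEquiv Λ q) = realify (compress Λ H) p q := by
  simp [reOp]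

/-- kernel: inversion commutes with the re-indexing. [cite: BalabanImbrieJaffe1988, (2.40) p.264] -/
theorem reOp_inv : (reOp Λ H)⁻¹ = Matrix.reindex (idxEquiv Λ) (idxEquiv Λ) (realify (compress Λ H))⁻¹ :=
  Matrix.inv_reindex _ _ _

/-- **the inverse of the charted operator is the charted realification of `C = (H|_Λ)^{−1}`** (for `H|_Λ` invertible; gen 19's `realify_inv`).
[cite: BalabanImbrieJaffe1988, (2.40) p.264] -/
theorem reOp_inv_apply (hU : IsUnit (compress Λ H)) (p q : ↥Λ × Fin 2) :
    (reOp Λ H)⁻¹ (idxEquiv Λ p) (idxEquiv Λ q) = realify (compress Λ H)⁻¹ p q := by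
  rw [reOp_inv, realify_inv hU]
  simp

/-- **the `(Re, Re)` entries of the inverse are `Re C(x₁, x₂)`**. [cite: BalabanImbrieJaffe1988, (2.40) p.264] -/
theorem reOp_inv_apply_re (hU : IsUnit (compress Λ H)) (x₁ x₂ : ↥Λ) :
    (reOp Λ H)⁻¹ (idxEquiv Λ (x₁, 0)) (idxEquiv Λ (x₂, 0)) = ((compress Λ H)⁻¹ x₁ x₂).re := by
  rw [reOp_inv_apply hU, realify_apply_fst]

/-- **the `(Im, Re)` entries of the inverse are `Im C(x₁, x₂)`**. [cite: BalabanImbrieJaffe1988, (2.40) p.264] -/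
theorem reOp_inv_apply_im (hU : IsUnit (compress Λ H)) (x₁ x₂ : ↥Λ) :
    (reOp Λ H)⁻¹ (idxEquiv Λ (x₁, 1)) (idxEquiv Λ (x₂, 0)) = ((compress Λ H)⁻¹ x₁ x₂).im := by
  rw [reOp_inv_apply hU, realify_apply_snd]

/-- kernel: the charted operator acts as the realification on re-indexed vectors. [cite: BalabanImbrieJaffe1988, (2.40) p.264] -/
theorem reOp_mulVec (v : B4.Idx (chartSet Λ) 2 → ℝ) (p : ↥Λ × Fin 2) :
    (reOp Λ H *ᵥ v) (idxEquiv Λ p) = (realify (compress Λ H) *ᵥ (v ∘ idxEquiv Λ)) p := by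
  rw [reOp, Matrix.reindex_apply, Matrix.submatrix_mulVec_equiv]
  simp

end ReOp

/-! ## §3 [6] (5.6) for the charted operator from a coercive Hermitian form and a kernel bound in the chart distance -/

section Hyp56

variable {Λ : Finset (Balaban1983to89.Site P j)} {H : Matrix (Balaban1983to89.Site P j) (Balaban1983to89.Site P j) ℂ}

/-- **[6] (5.6) FOR THE CHARTED REAL OPERATOR OF A COMPLEX OPERATOR `H` ON `Λ ⊆ T^{(k)}`** (*"A ≥ γ₀I, |A(x,x′)| ≤ c₀e^{−δ₀|x−x′|}, x, x′ ∈ Ω …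
a symmetric operator"*, [6] p. 594): if `H|_Λ` is Hermitian, its form is coercive on `ℓ²(Λ)`, `γΣ_i‖v_i‖² ≤ Re vᴴ(H|_Λ)v`, and its kernel obeys
`‖H(x₁, x₂)‖ ≤ c₀e^{−δ₀|x₁−x₂|_chart}` on `Λ × Λ`, then `reOp Λ H` satisfies `B4.Hyp56 Λ′ · γ c₀ δ₀` — symmetric (gen 18's `realify_isSymm`),
coercive (gen 19's `coercive_realify`), kernel bounded (`|realify entries| ≤ ‖complex entry‖`, `abs_realify_apply_le`).
[cite: Balaban1983RegularityDecay, (5.6) p.594] [cite: BalabanImbrieJaffe1988, (2.40) p.264] -/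
theorem hyp56_reOp (hH : (compress Λ H).IsHermitian) {γ : ℝ}
    (hcoer : ∀ v : ↥Λ → ℂ, γ * ∑ i, ‖v i‖ ^ 2 ≤ (star v ⬝ᵥ (compress Λ H *ᵥ v)).re)
    {c₀ δ₀ : ℝ} (hker : ∀ x₁ ∈ Λ, ∀ x₂ ∈ Λ, ‖H x₁ x₂‖ ≤ c₀ * Real.exp (-(δ₀ * cdist x₁ x₂))) :
    B4.Hyp56 (chartSet Λ) (reOp Λ H) γ c₀ δ₀ := by
  refine ⟨(realify_isSymm hH).submatrix _, fun v => ?_, fun p q => ?_⟩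
  · -- the form, read on `w = v ∘ idxEquiv Λ`
    have hc := coercive_realify hcoer (v ∘ idxEquiv Λ)
    have h1 : ∑ p, v p ^ 2 = (v ∘ idxEquiv Λ) ⬝ᵥ (v ∘ idxEquiv Λ) := by
      rw [dotProduct, ← (idxEquiv Λ).sum_comp]
      exact sum_congr rfl fun p _ => by rw [Function.comp_apply, sq]
    have h2 : ∑ p, v p * (reOp Λ H *ᵥ v) p = (v ∘ idxEquiv Λ) ⬝ᵥ (realify (compress Λ H) *ᵥ (v ∘ idxEquiv Λ)) := by
      rw [dotProduct, ← (idxEquiv Λ).sum_comp]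
      exact sum_congr rfl fun p _ => by rw [Function.comp_apply, reOp_mulVec]
    rw [h1, h2]
    exact hc
  · obtain ⟨p', rfl⟩ := (idxEquiv Λ).surjective p
    obtain ⟨q', rfl⟩ := (idxEquiv Λ).surjective q
    rw [reOp_apply, dist_idxEquiv]
    exact (abs_realify_apply_le _ p' q').trans (hker p'.1.1 p'.1.2 q'.1.1 q'.1.2)

end Hyp56

/-! ## §4 [6] (5.6) for `(Δ + κP(u))|_Λ` AT A SMALL FIELD: *"by (2.38), C^{(k)}_Λ(u)^{−1} is bounded below"* + the kernel decay of `Δ` -/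

section Op240

/-- kernel: **the kernel of `Δ + κP(u)` decays in the chart distance like the kernel of `Δ`**: `‖Δ(x₁,x₂)‖ ≤ c_Δe^{−δ₀|x₁−x₂|_chart}` gives
`‖(Δ + κP(u))(x₁,x₂)‖ ≤ (c_Δ + κL^{−2d}e^{δ₀(L−1)})e^{−δ₀|x₁−x₂|_chart}` (`P(u)` has range one `L`-block, two sites of a block are at chart distance
`≤ L − 1`; the chart twin of gen 19's `norm_op240_apply_le`). [cite: BalabanImbrieJaffe1988, (2.40) p.264] -/
theorem norm_op240_apply_le_cdist (hj : j + 1 ≤ P.m + P.K) (U : GaugeField P j U1)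
    {Δ : Matrix (Balaban1983to89.Site P j) (Balaban1983to89.Site P j) ℂ} {κ cΔ δ₀ : ℝ} (hκ : 0 ≤ κ) (hδ₀ : 0 ≤ δ₀)
    {x₁ x₂ : Balaban1983to89.Site P j} (hΔ : ‖Δ x₁ x₂‖ ≤ cΔ * Real.exp (-(δ₀ * cdist x₁ x₂))) :
    ‖op240 Δ κ U x₁ x₂‖ ≤
      (cΔ + κ * (((P.L : ℝ) ^ P.d)⁻¹) ^ 2 * Real.exp (δ₀ * ((P.L : ℝ) - 1))) * Real.exp (-(δ₀ * cdist x₁ x₂)) := by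
  rw [op240, Matrix.add_apply, Matrix.smul_apply, smul_eq_mul]
  have hP : ‖(κ : ℂ) * pOp U x₁ x₂‖ ≤
      κ * (((P.L : ℝ) ^ P.d)⁻¹) ^ 2 * Real.exp (δ₀ * ((P.L : ℝ) - 1)) * Real.exp (-(δ₀ * cdist x₁ x₂)) := by
    by_cases hb : blkIter 1 x₁ = blkIter 1 x₂
    · have hT := cdist_le_of_blkIter_eq hj hb
      rw [norm_mul, Complex.norm_real, Real.norm_of_nonneg hκ, mul_assoc, mul_assoc]
      refine mul_le_mul_of_nonneg_left ?_ hκ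
      have hexp : Real.exp (-(δ₀ * ((P.L : ℝ) - 1))) ≤ Real.exp (-(δ₀ * cdist x₁ x₂)) :=
        Real.exp_le_exp.2 (by nlinarith)
      calc ‖pOp U x₁ x₂‖ ≤ (((P.L : ℝ) ^ P.d)⁻¹) ^ 2 := norm_pOp_apply_le U x₁ x₂
        _ = (((P.L : ℝ) ^ P.d)⁻¹) ^ 2 * (Real.exp (δ₀ * ((P.L : ℝ) - 1)) * Real.exp (-(δ₀ * ((P.L : ℝ) - 1)))) := by
            rw [← Real.exp_add, add_neg_cancel, Real.exp_zero, mul_one]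
        _ ≤ (((P.L : ℝ) ^ P.d)⁻¹) ^ 2 * (Real.exp (δ₀ * ((P.L : ℝ) - 1)) * Real.exp (-(δ₀ * cdist x₁ x₂))) :=
            mul_le_mul_of_nonneg_left (mul_le_mul_of_nonneg_left hexp (Real.exp_pos _).le) (by positivity)
    · rw [pOp_apply_of_ne U hb, mul_zero, norm_zero]; positivity
  calc ‖Δ x₁ x₂ + (κ : ℂ) * pOp U x₁ x₂‖ ≤ ‖Δ x₁ x₂‖ + ‖(κ : ℂ) * pOp U x₁ x₂‖ := norm_add_le _ _
    _ ≤ cΔ * Real.exp (-(δ₀ * cdist x₁ x₂)) +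
          κ * (((P.L : ℝ) ^ P.d)⁻¹) ^ 2 * Real.exp (δ₀ * ((P.L : ℝ) - 1)) * Real.exp (-(δ₀ * cdist x₁ x₂)) :=
        add_le_add hΔ hP
    _ = _ := by ring

/-- **[6] (5.6) FOR THE MODEL'S `(Δ + κP(u))|_Λ` AT A SMALL (NON-FLAT) FIELD** — the two printed inputs of the walk expansion: p. 264 *"This is of
course a nonlocal operator, but by (2.38), C^{(k)}_Λ(u)^{−1} is bounded below"* and (2.36) *"|Δ_{k,loc}(u; x₁, x₂)| ≦ ce^{−c|x₁−x₂|}"*.  On `T^{(k)}`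
(any level with a next one), let the bond field `u` satisfy `|u(b) − 1| ≤ T` on the bonds inside the `L`-blocks and have holonomy deviation `≤ δ`,
`2(L−1)L·d·T² + 2δ² ≤ σ`; let the Hermitian `Δ` satisfy the PRINTED (2.38)-shape bound `γΣ_b|u(b)φ(b₊)−φ(b₋)|² − E‖φ‖² ≤ Re φᴴΔφ` on the fields
supported in `Λ` and the (2.36)-shape kernel bound `‖Δ(x₁,x₂)‖ ≤ c_Δe^{−δ₀|x₁−x₂|_chart}` on `Λ × Λ`.  Then the charted real operator of
`(Δ + κP(u))|_Λ` satisfies [6] (5.6) with `γ₀ = c₀(γ,κ)(1 − σ) − E` (gen 19's `re_coercive_compress_smallField`: the block Poincaré step WITH its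
smallness terms), `c₀ = c_Δ + κL^{−2d}e^{δ₀(L−1)}` and the rate `δ₀`. [cite: BalabanImbrieJaffe1988, (2.38), (2.40) p.264]
[cite: Balaban1983RegularityDecay, (5.6) p.594] -/
theorem hyp56_op240_smallField (hj : j + 1 ≤ P.m + P.K) (U : GaugeField P j U1) {T δ σ : ℝ}
    (hInt : ∀ b : PBond P j, blkIter 1 b.src = blkIter 1 b.tgt → ‖toC (U b) - 1‖ ≤ T)
    (hTree : ∀ x : Balaban1983to89.Site P j, ‖holCK U 1 x - 1‖ ≤ δ)
    (hσ : 2 * (((P.L : ℝ) - 1) * P.L) * P.d * T ^ 2 + 2 * δ ^ 2 ≤ σ)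
    {Δ : Matrix (Balaban1983to89.Site P j) (Balaban1983to89.Site P j) ℂ} (hΔ : Δ.IsHermitian)
    {Λ : Finset (Balaban1983to89.Site P j)} {γ E κ : ℝ} (hγ : 0 ≤ γ) (hκ : 0 ≤ κ)
    (h238 : ∀ φ : Balaban1983to89.Site P j → ℂ, (∀ x ∉ Λ, φ x = 0) →
      γ * ∑ b : PBond P j, ‖toC (U b) * φ b.tgt - φ b.src‖ ^ 2 - E * ∑ x, ‖φ x‖ ^ 2 ≤ (star φ ⬝ᵥ (Δ *ᵥ φ)).re)
    {cΔ δ₀ : ℝ} (hδ₀ : 0 ≤ δ₀)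
    (hker : ∀ x₁ ∈ Λ, ∀ x₂ ∈ Λ, ‖Δ x₁ x₂‖ ≤ cΔ * Real.exp (-(δ₀ * cdist x₁ x₂))) :
    B4.Hyp56 (chartSet Λ) (reOp Λ (op240 Δ κ U)) (c240 P γ κ * (1 - σ) - E)
      (cΔ + κ * (((P.L : ℝ) ^ P.d)⁻¹) ^ 2 * Real.exp (δ₀ * ((P.L : ℝ) - 1))) δ₀ :=
  hyp56_reOp ((op240_isHermitian hΔ κ U).submatrix _) (re_coercive_compress_smallField hj U hInt hTree hσ hγ hκ h238)
    fun x₁ h₁ x₂ h₂ => norm_op240_apply_le_cdist hj U hκ hδ₀ (hker x₁ h₁ x₂ h₂)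

end Op240

/-! ## §5 (2.42), (2.45), (2.41), (2.43), (2.46), (2.47) for `C = (H|_Λ)^{−1}` from [6] (5.6) of the charted operator — p13 BY NAME -/

section Transport

variable {Λ : Finset (Balaban1983to89.Site P j)} {H : Matrix (Balaban1983to89.Site P j) (Balaban1983to89.Site P j) ℂ} {γ₀ c₀ δ₀ : ℝ}

/-- **(2.42) FOR `C = (H|_Λ)^{−1}` ON THE TORUS** (*"there is a random walk expansion for C^{(k)}_Λ(u), C^{(k)}_Λ(u; x₁, x₂) =
Σ_ω C^{(k)}_{Λ,ω}(u, x₁, x₂), (2.42) where ω is a walk on a lattice of spacing M"*): if the charted real operator of `H|_Λ` satisfies [6] (5.6)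
(`B4.Hyp56 Λ′ · γ₀ c₀ δ₀`) and `H|_Λ` is invertible, then for `M ≥ 5`, `M > K_R`, `M > Θ₁` (p13's constants at `d`, `N = 2`) the real and imaginary
parts of `C(x₁, x₂)` — the entries of gen 18's `realify C` — are the unconditional sums over ALL walks `ω` on the `M`-cubes of the charted `Λ` of
p13's walk terms `C_ω` of the charted operator: `realify C (p, q) = Σ_ω C_ω(e p, e q)` (`BIJ88RandomWalk242.Eq242` INHABITED for the model's
covariance; p13's `eq242_lattice` BY NAME). [cite: BalabanImbrieJaffe1988, (2.42) p.264] -/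
theorem eq242_realify_inv (hγ : 0 < γ₀) (hc : 0 ≤ c₀) (hδ : 0 < δ₀) (hA : B4.Hyp56 (chartSet Λ) (reOp Λ H) γ₀ c₀ δ₀)
    (hU : IsUnit (compress Λ H)) {M : ℕ} (hM : 5 ≤ M) (hMR : kR P.d 2 γ₀ c₀ δ₀ < M) (hMθ : thetaConst P.d 2 γ₀ c₀ δ₀ < M) :
    Eq242 (fun p q : ↥Λ × Fin 2 => realify (compress Λ H)⁻¹ p q)
      (fun ω p q => latticeCw M (chartSet Λ) 2 (reOp Λ H) ω (idxEquiv Λ p) (idxEquiv Λ q)) := by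
  intro p q
  have h := eq242_lattice hγ hc hδ hA hM hMR hMθ (idxEquiv Λ p) (idxEquiv Λ q)
  dsimp only at h ⊢
  rwa [reOp_inv_apply hU] at h

/-- **(2.42) IN COMPLEX FORM**: `C(x₁, x₂) = Σ_ω C^ℂ_ω(x₁, x₂)` with `C^ℂ_ω(x₁,x₂) = C_ω((x₁,Re),(x₂,Re)) + i·C_ω((x₁,Im),(x₂,Re))` (the first
column of the realified `2 × 2` block of the walk term), the sum over all walks converging unconditionally in `ℂ`.
[cite: BalabanImbrieJaffe1988, (2.42) p.264] -/
theorem hasSum_walkTerms_inv (hγ : 0 < γ₀) (hc : 0 ≤ c₀) (hδ : 0 < δ₀) (hA : B4.Hyp56 (chartSet Λ) (reOp Λ H) γ₀ c₀ δ₀)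
    (hU : IsUnit (compress Λ H)) {M : ℕ} (hM : 5 ≤ M) (hMR : kR P.d 2 γ₀ c₀ δ₀ < M) (hMθ : thetaConst P.d 2 γ₀ c₀ δ₀ < M) (x₁ x₂ : ↥Λ) :
    HasSum (fun ω : Walk ↥(labels M (chartSet Λ)) =>
        (⟨latticeCw M (chartSet Λ) 2 (reOp Λ H) ω (idxEquiv Λ (x₁, 0)) (idxEquiv Λ (x₂, 0)),
          latticeCw M (chartSet Λ) 2 (reOp Λ H) ω (idxEquiv Λ (x₁, 1)) (idxEquiv Λ (x₂, 0))⟩ : ℂ))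
      ((compress Λ H)⁻¹ x₁ x₂) := by
  rw [Complex.hasSum_iff]
  refine ⟨?_, ?_⟩
  · have h := eq242_realify_inv hγ hc hδ hA hU hM hMR hMθ (x₁, 0) (x₂, 0)
    dsimp only at h ⊢
    rwa [realify_apply_fst] at h
  · have h := eq242_realify_inv hγ hc hδ hA hU hM hMR hMθ (x₁, 1) (x₂, 0)
    dsimp only at h ⊢
    rwa [realify_apply_snd] at h

/-- **(2.45) FOR `C = (H|_Λ)^{−1}` ON THE TORUS** (*"C^{(k)}_Λ(u) = C^{(k)}_{Λ,loc}(u) + Σ_X C^{(k)}_{Λ,X}(u), (2.45)"*): the realified entries of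
`C` ARE their local part (walks within `ρ` label units of both arguments) plus the sum over cube regions `X` (`r(e_k)`-cubes of `s` labels a side,
touching adjacency) of the `X`-parts — p13's `eq245_lattice` with its label distance `ldist`, cubes `cubeOf M s` and `touch`, read through the chart.
[cite: BalabanImbrieJaffe1988, (2.45) p.264] -/
theorem eq245_realify_inv (hγ : 0 < γ₀) (hc : 0 ≤ c₀) (hδ : 0 < δ₀) (hA : B4.Hyp56 (chartSet Λ) (reOp Λ H) γ₀ c₀ δ₀)
    (hU : IsUnit (compress Λ H)) {M : ℕ} (hM : 5 ≤ M) (hMR : kR P.d 2 γ₀ c₀ δ₀ < M) (hMθ : thetaConst P.d 2 γ₀ c₀ δ₀ < M)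
    (ρ : ℝ) (s : ℕ) :
    BIJ88Sect2Statements.Eq245 (fun p q : ↥Λ × Fin 2 => realify (compress Λ H)⁻¹ p q)
      (fun p q => cLoc (ldist (N := 2) M) ρ (fun ω y₁ y₂ => latticeCw M (chartSet Λ) 2 (reOp Λ H) ω y₁ y₂) (idxEquiv Λ p) (idxEquiv Λ q))
      (fun X p q => cX (ldist (N := 2) M) ρ (cubeOf M s) touch (fun ω y₁ y₂ => latticeCw M (chartSet Λ) 2 (reOp Λ H) ω y₁ y₂) X
        (idxEquiv Λ p) (idxEquiv Λ q)) := by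
  classical
  intro p q
  have h := eq245_lattice hγ hc hδ hA hM hMR hMθ (ldist (N := 2) M) ρ (cubeOf M s) touch (idxEquiv Λ p) (idxEquiv Λ q)
  dsimp only at h ⊢
  rwa [reOp_inv_apply hU] at h

/-- **(2.41) BY THE PRINTED ROUTE** (*"by (2.38), C^{(k)}_Λ(u)^{−1} is bounded below and a random walk expansion as in [6] can be used to prove that
|C^{(k)}_Λ(u; x₁, x₂)| ≦ ce^{−c|x₁−x₂|}. (2.41)"*): summing the whole walk expansion (2.42) (p13's `abs_inv_lattice_le`), every realified entry of
`C` obeys `|realify C (p, q)| ≤ 2^dγ₀^{−1}(1 − θ_W)^{−1}e^{δ₀/4}·e^{−(δ₀/8)|x_p − x_q|_chart/M}` (gen 19 proved (2.41) by finite Combes–Thomas instead;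
this is the walk-route twin). [cite: BalabanImbrieJaffe1988, (2.41) p.264] -/
theorem abs_realify_inv_le_walk (hγ : 0 < γ₀) (hc : 0 ≤ c₀) (hδ : 0 < δ₀) (hA : B4.Hyp56 (chartSet Λ) (reOp Λ H) γ₀ c₀ δ₀)
    (hU : IsUnit (compress Λ H)) {M : ℕ} (hM : 5 ≤ M) (hMR : kR P.d 2 γ₀ c₀ δ₀ < M) (hMθ : thetaConst P.d 2 γ₀ c₀ δ₀ < M)
    (hθW : thetaW P.d 2 γ₀ c₀ δ₀ M < 1) (p q : ↥Λ × Fin 2) :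
    |realify (compress Λ H)⁻¹ p q| ≤ 2 ^ P.d * γ₀⁻¹ * (1 - thetaW P.d 2 γ₀ c₀ δ₀ M)⁻¹ * Real.exp (δ₀ / 4)
        * Real.exp (-(δ₀ / 8) * (cdist p.1.1 q.1.1 / M)) := by
  have h := abs_inv_lattice_le hγ hc hδ hA hM hMR hMθ hθW (idxEquiv Λ p) (idxEquiv Λ q)
  rwa [reOp_inv_apply hU, sdist, dist_idxEquiv] at h

/-- **(2.41) BY THE PRINTED ROUTE, COMPLEX FORM, IN THE TORUS DISTANCE**: `‖C(x₁, x₂)‖ ≤ 2·2^dγ₀^{−1}(1 − θ_W)^{−1}e^{δ₀/4}·e^{−(δ₀/8)|x₁ − x₂|_T/M}`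
(`‖z‖ ≤ |Re z| + |Im z|`; the torus distance is dominated by the chart distance). [cite: BalabanImbrieJaffe1988, (2.41) p.264] -/
theorem norm_inv_apply_le_walk (hγ : 0 < γ₀) (hc : 0 ≤ c₀) (hδ : 0 < δ₀) (hA : B4.Hyp56 (chartSet Λ) (reOp Λ H) γ₀ c₀ δ₀)
    (hU : IsUnit (compress Λ H)) {M : ℕ} (hM : 5 ≤ M) (hMR : kR P.d 2 γ₀ c₀ δ₀ < M) (hMθ : thetaConst P.d 2 γ₀ c₀ δ₀ < M)
    (hθW : thetaW P.d 2 γ₀ c₀ δ₀ M < 1) (x₁ x₂ : ↥Λ) :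
    ‖(compress Λ H)⁻¹ x₁ x₂‖ ≤ 2 * (2 ^ P.d * γ₀⁻¹ * (1 - thetaW P.d 2 γ₀ c₀ δ₀ M)⁻¹ * Real.exp (δ₀ / 4))
        * Real.exp (-(δ₀ / 8) * (B5Ineq137Torus.T P j x₁.1 x₂.1 / M)) := by
  have hre := abs_realify_inv_le_walk hγ hc hδ hA hU hM hMR hMθ hθW (x₁, 0) (x₂, 0)
  have him := abs_realify_inv_le_walk hγ hc hδ hA hU hM hMR hMθ hθW (x₁, 1) (x₂, 0)
  rw [realify_apply_fst] at hre
  rw [realify_apply_snd] at him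
  have hK : 0 ≤ 2 ^ P.d * γ₀⁻¹ * (1 - thetaW P.d 2 γ₀ c₀ δ₀ M)⁻¹ * Real.exp (δ₀ / 4) := by
    have : 0 < 1 - thetaW P.d 2 γ₀ c₀ δ₀ M := by linarith
    positivity
  have hM0 : (0 : ℝ) ≤ M := Nat.cast_nonneg M
  have hexp : Real.exp (-(δ₀ / 8) * (cdist x₁.1 x₂.1 / M)) ≤ Real.exp (-(δ₀ / 8) * (B5Ineq137Torus.T P j x₁.1 x₂.1 / M)) :=
    Real.exp_le_exp.2 (by
      have := div_le_div_of_nonneg_right (T_le_cdist x₁.1 x₂.1) hM0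
      nlinarith)
  calc ‖(compress Λ H)⁻¹ x₁ x₂‖ ≤ |((compress Λ H)⁻¹ x₁ x₂).re| + |((compress Λ H)⁻¹ x₁ x₂).im| :=
        Complex.norm_le_abs_re_add_abs_im _
    _ ≤ 2 * (2 ^ P.d * γ₀⁻¹ * (1 - thetaW P.d 2 γ₀ c₀ δ₀ M)⁻¹ * Real.exp (δ₀ / 4)) * Real.exp (-(δ₀ / 8) * (cdist x₁.1 x₂.1 / M)) := by
        linarith
    _ ≤ _ := mul_le_mul_of_nonneg_left hexp (by positivity)

/-- **(2.43) «The local covariance … is bounded as in (2.41)»** for `C = (H|_Λ)^{−1}` on the torus: the local part of the realified entries obeys the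
same bound (p13's `abs_cLoc_lattice_le`, read through the chart). [cite: BalabanImbrieJaffe1988, (2.43) p.264] -/
theorem abs_cLoc_le_walk (hγ : 0 < γ₀) (hc : 0 ≤ c₀) (hδ : 0 < δ₀) (hA : B4.Hyp56 (chartSet Λ) (reOp Λ H) γ₀ c₀ δ₀)
    {M : ℕ} (hM : 5 ≤ M) (hMR : kR P.d 2 γ₀ c₀ δ₀ < M) (hMθ : thetaConst P.d 2 γ₀ c₀ δ₀ < M)
    (hθW : thetaW P.d 2 γ₀ c₀ δ₀ M < 1) (ρ : ℝ) (p q : ↥Λ × Fin 2) :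
    |cLoc (ldist (N := 2) M) ρ (fun ω y₁ y₂ => latticeCw M (chartSet Λ) 2 (reOp Λ H) ω y₁ y₂) (idxEquiv Λ p) (idxEquiv Λ q)|
      ≤ 2 ^ P.d * γ₀⁻¹ * (1 - thetaW P.d 2 γ₀ c₀ δ₀ M)⁻¹ * Real.exp (δ₀ / 4) * Real.exp (-(δ₀ / 8) * (cdist p.1.1 q.1.1 / M)) := by
  have h := abs_cLoc_lattice_le hγ hc hδ hA hM hMR hMθ hθW ρ (idxEquiv Λ p) (idxEquiv Λ q)
  rwa [sdist, dist_idxEquiv] at h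

/-- **(2.46) FOR `C = (H|_Λ)^{−1}` ON THE TORUS, the bound half with two constants** (*"|C^{(k)}_{Λ,X}(u; x₁, x₂)| ≦ e^{−cr(e_k)|X|}. (2.46) Here and
elsewhere, |X| refers to the number of r(e_k)-cubes in X"*): `|C_{Λ,X}(e p, e q)| ≤ K₀·e^{−(δ₀s/(64·9^d))|X|}` for every region `X` of
`r(e_k)`-cubes (`s` labels a side), `K₀ = 2^dγ₀^{−1}(1−θ_W)^{−1}e^{δ₀/8}` — p13's `abs_cX_lattice_le` on the charted operator.
[cite: BalabanImbrieJaffe1988, (2.46) p.264] -/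
theorem abs_cX_le_walk (hγ : 0 < γ₀) (hc : 0 ≤ c₀) (hδ : 0 < δ₀) (hA : B4.Hyp56 (chartSet Λ) (reOp Λ H) γ₀ c₀ δ₀)
    {M : ℕ} (hM : 5 ≤ M) (hMR : kR P.d 2 γ₀ c₀ δ₀ < M) (hMθ : thetaConst P.d 2 γ₀ c₀ δ₀ < M)
    (hθW : thetaW P.d 2 γ₀ c₀ δ₀ M < 1) {s : ℕ} (hs : 0 < s) (X : Finset (Cubes M s (chartSet Λ))) (p q : ↥Λ × Fin 2) :
    |cX (ldist (N := 2) M) ((s : ℝ) / 4) (cubeOf M s) touch (fun ω y₁ y₂ => latticeCw M (chartSet Λ) 2 (reOp Λ H) ω y₁ y₂) X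
        (idxEquiv Λ p) (idxEquiv Λ q)|
      ≤ K0 P.d 2 γ₀ c₀ δ₀ M * Real.exp (-(δ₀ * s / (64 * 9 ^ P.d) * X.card)) :=
  abs_cX_lattice_le hγ hc hδ hA hM hMR hMθ hθW hs X (idxEquiv Λ p) (idxEquiv Λ q)

/-- **(2.46) AS THE TYPED ROW `BIJ88Sect2Statements.Ineq246` FOR `C = (H|_Λ)^{−1}` ON THE TORUS** — support clause (*"It vanishes unless both
arguments are in X"*) and the printed one-constant form `e^{−c·r·|X|}` with `r = s` label units (`= r(e_k)/M`), `c = δ₀/(128·9^d)`, once `r(e_k)` is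
large enough to absorb `K₀` (`K₀ ≤ e^{c·s}`; p. 260: `r(e_k) → ∞`) — p13's `ineq246_lattice`, indices read through the chart.
[cite: BalabanImbrieJaffe1988, (2.46) p.264] -/
theorem ineq246_walk (hγ : 0 < γ₀) (hc : 0 ≤ c₀) (hδ : 0 < δ₀) (hA : B4.Hyp56 (chartSet Λ) (reOp Λ H) γ₀ c₀ δ₀)
    {M : ℕ} (hM : 5 ≤ M) (hMR : kR P.d 2 γ₀ c₀ δ₀ < M) (hMθ : thetaConst P.d 2 γ₀ c₀ δ₀ < M)
    (hθW : thetaW P.d 2 γ₀ c₀ δ₀ M < 1) {s : ℕ} (hs : 0 < s) (hlarge : K0 P.d 2 γ₀ c₀ δ₀ M ≤ Real.exp (δ₀ / (128 * 9 ^ P.d) * s)) :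
    BIJ88Sect2Statements.Ineq246 (fun X : Finset (Cubes M s (chartSet Λ)) => X.card)
      (fun (p : ↥Λ × Fin 2) (X : Finset (Cubes M s (chartSet Λ))) =>
        memX (fun (x : B4.Idx (chartSet Λ) 2) (l : ↥(labels M (chartSet Λ))) => InBox M l.1 (x.1 : Fin P.d → ℤ)) (cubeOf M s) touch
          (idxEquiv Λ p) X)
      (fun X p q => cX (ldist (N := 2) M) ((s : ℝ) / 4) (cubeOf M s) touch (fun ω y₁ y₂ => latticeCw M (chartSet Λ) 2 (reOp Λ H) ω y₁ y₂) X
        (idxEquiv Λ p) (idxEquiv Λ q))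
      (δ₀ / (128 * 9 ^ P.d)) s := by
  obtain ⟨h1, h2⟩ := ineq246_lattice hγ hc hδ hA hM hMR hMθ hθW hs hlarge
  exact ⟨fun X p q => h1 X _ _, fun X p q => h2 X _ _⟩

/-- **(2.47) FOR `C = (H|_Λ)^{−1}` ON THE TORUS, two constants** (*"This estimate can be summed over all connected sets X to show that
|C^{(k)}_{Λ,loc}(u; x₁, x₂) − C^{(k)}_Λ(u; x₁, x₂)| ≦ e^{−cr(e_k)}e^{−c|x₁−x₂|}. (2.47)"*): the tail of the primed sum,
`|C_{Λ,loc}(e p, e q) − realify C (p, q)| ≤ 2^dγ₀^{−1}(1−θ_W)^{−1}e^{−(δ₀/8)(ρ − 1)}` — p13's `abs_cLoc_sub_inv_le` with `A^{−1}` identified with the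
realified covariance. [cite: BalabanImbrieJaffe1988, (2.47) p.265] -/
theorem abs_cLoc_sub_realify_inv_le (hγ : 0 < γ₀) (hc : 0 ≤ c₀) (hδ : 0 < δ₀) (hA : B4.Hyp56 (chartSet Λ) (reOp Λ H) γ₀ c₀ δ₀)
    (hU : IsUnit (compress Λ H)) {M : ℕ} (hM : 5 ≤ M) (hMR : kR P.d 2 γ₀ c₀ δ₀ < M) (hMθ : thetaConst P.d 2 γ₀ c₀ δ₀ < M)
    (hθW : thetaW P.d 2 γ₀ c₀ δ₀ M < 1) (ρ : ℝ) (p q : ↥Λ × Fin 2) :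
    |cLoc (ldist (N := 2) M) ρ (fun ω y₁ y₂ => latticeCw M (chartSet Λ) 2 (reOp Λ H) ω y₁ y₂) (idxEquiv Λ p) (idxEquiv Λ q)
        - realify (compress Λ H)⁻¹ p q|
      ≤ 2 ^ P.d * γ₀⁻¹ * (1 - thetaW P.d 2 γ₀ c₀ δ₀ M)⁻¹ * Real.exp (-(δ₀ / 8 * (ρ - 1))) := by
  have h := abs_cLoc_sub_inv_le hγ hc hδ hA hM hMR hMθ hθW ρ (idxEquiv Λ p) (idxEquiv Λ q)
  rwa [reOp_inv_apply hU] at h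

/-- **(2.47) AS THE TYPED ROW `BIJ88Sect2Statements.Close` FOR `C = (H|_Λ)^{−1}` ON THE TORUS** (with the printed `e^{−c|x₁−x₂|}` factor, site
distance in label units `|x_p − x_q|_chart/M`): `Close (|·−·|_chart/M) C_{Λ,loc} (realify C) δ c`, `c = δ₀/16`,
`δ = 2^dγ₀^{−1}(1−θ_W)^{−1}e^{−(δ₀/16)(ρ−3)}` — p13's `close247_lattice`. [cite: BalabanImbrieJaffe1988, (2.47) p.265] -/
theorem close247_walk (hγ : 0 < γ₀) (hc : 0 ≤ c₀) (hδ : 0 < δ₀) (hA : B4.Hyp56 (chartSet Λ) (reOp Λ H) γ₀ c₀ δ₀)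
    (hU : IsUnit (compress Λ H)) {M : ℕ} (hM : 5 ≤ M) (hMR : kR P.d 2 γ₀ c₀ δ₀ < M) (hMθ : thetaConst P.d 2 γ₀ c₀ δ₀ < M)
    (hθW : thetaW P.d 2 γ₀ c₀ δ₀ M < 1) (ρ : ℝ) :
    BIJ88Sect2Statements.Close (fun p q : ↥Λ × Fin 2 => cdist p.1.1 q.1.1 / M)
      (fun p q => cLoc (ldist (N := 2) M) ρ (fun ω y₁ y₂ => latticeCw M (chartSet Λ) 2 (reOp Λ H) ω y₁ y₂) (idxEquiv Λ p) (idxEquiv Λ q))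
      (fun p q => realify (compress Λ H)⁻¹ p q)
      (2 ^ P.d * γ₀⁻¹ * (1 - thetaW P.d 2 γ₀ c₀ δ₀ M)⁻¹ * Real.exp (-(δ₀ / 16 * (ρ - 3)))) (δ₀ / 16) := by
  intro p q
  have h := close247_lattice hγ hc hδ hA hM hMR hMθ hθW ρ (idxEquiv Λ p) (idxEquiv Λ q)
  simp only [] at h
  rwa [reOp_inv_apply hU, sdist, dist_idxEquiv] at h

end Transport

/-! ## §6 THE SMALL-FIELD MEMBERS: (2.42), (2.45), (2.41), (2.46), (2.47) for `C^{(k)}_Λ(u) = [(Δ + κP(u))|_Λ]^{−1}` under the (2.38)-shape and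
(2.36)-shape bounds (gen 19's abstraction level; §4 + §5) -/

section SmallField

variable {Λ : Finset (Balaban1983to89.Site P j)} {Δ : Matrix (Balaban1983to89.Site P j) (Balaban1983to89.Site P j) ℂ}

/-- kernel: the (5.6) kernel constant `c_Δ + κL^{−2d}e^{δ₀(L−1)}` is non-negative. [cite: BalabanImbrieJaffe1988, (2.40) p.264] -/
private theorem c56_nonneg (P : Params) {κ cΔ δ₀ : ℝ} (hκ : 0 ≤ κ) (hcΔ : 0 ≤ cΔ) :
    0 ≤ cΔ + κ * (((P.L : ℝ) ^ P.d)⁻¹) ^ 2 * Real.exp (δ₀ * ((P.L : ℝ) - 1)) := by positivity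

/-- **(2.42) FOR THE MODEL'S `C^{(k)}_Λ(u) = [(Δ + κP(u))|_Λ]^{−1}` AT A SMALL (NON-FLAT) FIELD** (*"As in [6], there is a random walk expansion for
C^{(k)}_Λ(u), C^{(k)}_Λ(u; x₁, x₂) = Σ_ω C^{(k)}_{Λ,ω}(u, x₁, x₂), (2.42) based on the exponential decay of (Δ(u) + …)"*, p. 264): on `T^{(k)}` (any
level with a next one), let the bond field `u` satisfy `|u(b) − 1| ≤ T` on the bonds inside the `L`-blocks and have holonomy deviation `≤ δ`,
`2(L−1)L·d·T² + 2δ² ≤ σ`; let the Hermitian `Δ` satisfy the PRINTED (2.38)-shape bound on the fields supported in `Λ` with `E < c₀(γ,κ)(1 − σ)` and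
the (2.36)-shape kernel bound `‖Δ(x₁,x₂)‖ ≤ c_Δe^{−δ₀|x₁−x₂|_chart}` on `Λ × Λ`.  Then for cubes `M ≥ 5`, `M > K_R`, `M > Θ₁` (p13's [6]-constants at
`γ₀ = c₀(γ,κ)(1−σ) − E`, `c₀ = c_Δ + κL^{−2d}e^{δ₀(L−1)}`, `δ₀`, `N = 2`), for all `x₁, x₂ ∈ Λ`:
**`C^{(k)}_Λ(u; x₁, x₂) = Σ_ω C^ℂ_ω(x₁, x₂)`**, the sum over ALL walks on the `M`-cubes of the charted `Λ` converging unconditionally — §4's (5.6) fed to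
p13's `eq242_lattice`. [cite: BalabanImbrieJaffe1988, (2.42) p.264] -/
theorem eq242_smallField (hj : j + 1 ≤ P.m + P.K) (U : GaugeField P j U1) {T δ σ : ℝ}
    (hInt : ∀ b : PBond P j, blkIter 1 b.src = blkIter 1 b.tgt → ‖toC (U b) - 1‖ ≤ T)
    (hTree : ∀ x : Balaban1983to89.Site P j, ‖holCK U 1 x - 1‖ ≤ δ)
    (hσ : 2 * (((P.L : ℝ) - 1) * P.L) * P.d * T ^ 2 + 2 * δ ^ 2 ≤ σ) (hΔ : Δ.IsHermitian) {γ E κ : ℝ} (hγ : 0 ≤ γ) (hκ : 0 ≤ κ)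
    (hE : E < c240 P γ κ * (1 - σ))
    (h238 : ∀ φ : Balaban1983to89.Site P j → ℂ, (∀ x ∉ Λ, φ x = 0) →
      γ * ∑ b : PBond P j, ‖toC (U b) * φ b.tgt - φ b.src‖ ^ 2 - E * ∑ x, ‖φ x‖ ^ 2 ≤ (star φ ⬝ᵥ (Δ *ᵥ φ)).re)
    {cΔ δ₀ : ℝ} (hcΔ : 0 ≤ cΔ) (hδ₀ : 0 < δ₀) (hker : ∀ x₁ ∈ Λ, ∀ x₂ ∈ Λ, ‖Δ x₁ x₂‖ ≤ cΔ * Real.exp (-(δ₀ * cdist x₁ x₂)))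
    {M : ℕ} (hM : 5 ≤ M)
    (hMR : kR P.d 2 (c240 P γ κ * (1 - σ) - E) (cΔ + κ * (((P.L : ℝ) ^ P.d)⁻¹) ^ 2 * Real.exp (δ₀ * ((P.L : ℝ) - 1))) δ₀ < M)
    (hMθ : thetaConst P.d 2 (c240 P γ κ * (1 - σ) - E) (cΔ + κ * (((P.L : ℝ) ^ P.d)⁻¹) ^ 2 * Real.exp (δ₀ * ((P.L : ℝ) - 1))) δ₀ < M)
    (x₁ x₂ : ↥Λ) :
    HasSum (fun ω : Walk ↥(labels M (chartSet Λ)) =>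
        (⟨latticeCw M (chartSet Λ) 2 (reOp Λ (op240 Δ κ U)) ω (idxEquiv Λ (x₁, 0)) (idxEquiv Λ (x₂, 0)),
          latticeCw M (chartSet Λ) 2 (reOp Λ (op240 Δ κ U)) ω (idxEquiv Λ (x₁, 1)) (idxEquiv Λ (x₂, 0))⟩ : ℂ))
      ((compress Λ (op240 Δ κ U))⁻¹ x₁ x₂) :=
  hasSum_walkTerms_inv (by linarith) (c56_nonneg P hκ hcΔ) hδ₀ (hyp56_op240_smallField hj U hInt hTree hσ hΔ hγ hκ h238 hδ₀.le hker)
    (isUnit_compress_op240_smallField hj U hInt hTree hσ hγ hκ hE h238) hM hMR hMθ x₁ x₂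

/-- **(2.45) FOR THE MODEL'S `C^{(k)}_Λ(u)` AT A SMALL FIELD** (*"C^{(k)}_Λ(u) = C^{(k)}_{Λ,loc}(u) + Σ_X C^{(k)}_{Λ,X}(u), (2.45)"*): with the data of
`eq242_smallField`, the realified entries of `C^{(k)}_Λ(u)` equal their local part plus the sum over cube regions of the `X`-parts (p13's
`eq245_lattice` through §4). [cite: BalabanImbrieJaffe1988, (2.45) p.264] -/
theorem eq245_smallField (hj : j + 1 ≤ P.m + P.K) (U : GaugeField P j U1) {T δ σ : ℝ}
    (hInt : ∀ b : PBond P j, blkIter 1 b.src = blkIter 1 b.tgt → ‖toC (U b) - 1‖ ≤ T)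
    (hTree : ∀ x : Balaban1983to89.Site P j, ‖holCK U 1 x - 1‖ ≤ δ)
    (hσ : 2 * (((P.L : ℝ) - 1) * P.L) * P.d * T ^ 2 + 2 * δ ^ 2 ≤ σ) (hΔ : Δ.IsHermitian) {γ E κ : ℝ} (hγ : 0 ≤ γ) (hκ : 0 ≤ κ)
    (hE : E < c240 P γ κ * (1 - σ))
    (h238 : ∀ φ : Balaban1983to89.Site P j → ℂ, (∀ x ∉ Λ, φ x = 0) →
      γ * ∑ b : PBond P j, ‖toC (U b) * φ b.tgt - φ b.src‖ ^ 2 - E * ∑ x, ‖φ x‖ ^ 2 ≤ (star φ ⬝ᵥ (Δ *ᵥ φ)).re)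
    {cΔ δ₀ : ℝ} (hcΔ : 0 ≤ cΔ) (hδ₀ : 0 < δ₀) (hker : ∀ x₁ ∈ Λ, ∀ x₂ ∈ Λ, ‖Δ x₁ x₂‖ ≤ cΔ * Real.exp (-(δ₀ * cdist x₁ x₂)))
    {M : ℕ} (hM : 5 ≤ M)
    (hMR : kR P.d 2 (c240 P γ κ * (1 - σ) - E) (cΔ + κ * (((P.L : ℝ) ^ P.d)⁻¹) ^ 2 * Real.exp (δ₀ * ((P.L : ℝ) - 1))) δ₀ < M)
    (hMθ : thetaConst P.d 2 (c240 P γ κ * (1 - σ) - E) (cΔ + κ * (((P.L : ℝ) ^ P.d)⁻¹) ^ 2 * Real.exp (δ₀ * ((P.L : ℝ) - 1))) δ₀ < M)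
    (ρ : ℝ) (s : ℕ) :
    BIJ88Sect2Statements.Eq245 (fun p q : ↥Λ × Fin 2 => realify (compress Λ (op240 Δ κ U))⁻¹ p q)
      (fun p q => cLoc (ldist (N := 2) M) ρ (fun ω y₁ y₂ => latticeCw M (chartSet Λ) 2 (reOp Λ (op240 Δ κ U)) ω y₁ y₂)
        (idxEquiv Λ p) (idxEquiv Λ q))
      (fun X p q => cX (ldist (N := 2) M) ρ (cubeOf M s) touch (fun ω y₁ y₂ => latticeCw M (chartSet Λ) 2 (reOp Λ (op240 Δ κ U)) ω y₁ y₂) X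
        (idxEquiv Λ p) (idxEquiv Λ q)) :=
  eq245_realify_inv (by linarith) (c56_nonneg P hκ hcΔ) hδ₀ (hyp56_op240_smallField hj U hInt hTree hσ hΔ hγ hκ h238 hδ₀.le hker)
    (isUnit_compress_op240_smallField hj U hInt hTree hσ hγ hκ hE h238) hM hMR hMθ ρ s

/-- **(2.41) BY THE PRINTED WALK ROUTE FOR THE MODEL'S `C^{(k)}_Λ(u)` AT A SMALL FIELD, IN THE TORUS DISTANCE**: with the data of `eq242_smallField`
and `θ_W(M) < 1` ([6] (5.21)), `‖C^{(k)}_Λ(u; x₁, x₂)‖ ≤ 2·2^dγ₀^{−1}(1 − θ_W)^{−1}e^{δ₀/4}·e^{−(δ₀/8)|x₁ − x₂|_{T^{(k)}}/M}` uniformly in the torus and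
in `Λ` (§5's `norm_inv_apply_le_walk` through §4; gen 19's `decay241_smallField` is the Combes–Thomas twin). [cite: BalabanImbrieJaffe1988, (2.41) p.264] -/
theorem decay241_walk_smallField (hj : j + 1 ≤ P.m + P.K) (U : GaugeField P j U1) {T δ σ : ℝ}
    (hInt : ∀ b : PBond P j, blkIter 1 b.src = blkIter 1 b.tgt → ‖toC (U b) - 1‖ ≤ T)
    (hTree : ∀ x : Balaban1983to89.Site P j, ‖holCK U 1 x - 1‖ ≤ δ)
    (hσ : 2 * (((P.L : ℝ) - 1) * P.L) * P.d * T ^ 2 + 2 * δ ^ 2 ≤ σ) (hΔ : Δ.IsHermitian) {γ E κ : ℝ} (hγ : 0 ≤ γ) (hκ : 0 ≤ κ)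
    (hE : E < c240 P γ κ * (1 - σ))
    (h238 : ∀ φ : Balaban1983to89.Site P j → ℂ, (∀ x ∉ Λ, φ x = 0) →
      γ * ∑ b : PBond P j, ‖toC (U b) * φ b.tgt - φ b.src‖ ^ 2 - E * ∑ x, ‖φ x‖ ^ 2 ≤ (star φ ⬝ᵥ (Δ *ᵥ φ)).re)
    {cΔ δ₀ : ℝ} (hcΔ : 0 ≤ cΔ) (hδ₀ : 0 < δ₀) (hker : ∀ x₁ ∈ Λ, ∀ x₂ ∈ Λ, ‖Δ x₁ x₂‖ ≤ cΔ * Real.exp (-(δ₀ * cdist x₁ x₂)))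
    {M : ℕ} (hM : 5 ≤ M)
    (hMR : kR P.d 2 (c240 P γ κ * (1 - σ) - E) (cΔ + κ * (((P.L : ℝ) ^ P.d)⁻¹) ^ 2 * Real.exp (δ₀ * ((P.L : ℝ) - 1))) δ₀ < M)
    (hMθ : thetaConst P.d 2 (c240 P γ κ * (1 - σ) - E) (cΔ + κ * (((P.L : ℝ) ^ P.d)⁻¹) ^ 2 * Real.exp (δ₀ * ((P.L : ℝ) - 1))) δ₀ < M)
    (hθW : thetaW P.d 2 (c240 P γ κ * (1 - σ) - E) (cΔ + κ * (((P.L : ℝ) ^ P.d)⁻¹) ^ 2 * Real.exp (δ₀ * ((P.L : ℝ) - 1))) δ₀ M < 1)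
    (x₁ x₂ : ↥Λ) :
    ‖(compress Λ (op240 Δ κ U))⁻¹ x₁ x₂‖ ≤
      2 * (2 ^ P.d * (c240 P γ κ * (1 - σ) - E)⁻¹ *
          (1 - thetaW P.d 2 (c240 P γ κ * (1 - σ) - E) (cΔ + κ * (((P.L : ℝ) ^ P.d)⁻¹) ^ 2 * Real.exp (δ₀ * ((P.L : ℝ) - 1))) δ₀ M)⁻¹ *
          Real.exp (δ₀ / 4)) *
        Real.exp (-(δ₀ / 8) * (B5Ineq137Torus.T P j x₁.1 x₂.1 / M)) :=
  norm_inv_apply_le_walk (by linarith) (c56_nonneg P hκ hcΔ) hδ₀ (hyp56_op240_smallField hj U hInt hTree hσ hΔ hγ hκ h238 hδ₀.le hker)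
    (isUnit_compress_op240_smallField hj U hInt hTree hσ hγ hκ hE h238) hM hMR hMθ hθW x₁ x₂

/-- **(2.46) FOR THE MODEL'S `C^{(k)}_Λ(u)` AT A SMALL FIELD, AS THE TYPED ROW `BIJ88Sect2Statements.Ineq246`** (support clause + the printed
`e^{−c·r·|X|}`, `r = s` label units, `c = δ₀/(128·9^d)`, `r(e_k)` large enough to absorb `K₀`): with the data of `eq242_smallField`, `θ_W(M) < 1`,
`s ≥ 1` labels per `r(e_k)`-cube and `K₀ ≤ e^{c·s}` — §5's `ineq246_walk` through §4. [cite: BalabanImbrieJaffe1988, (2.46) p.264] -/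
theorem ineq246_smallField (hj : j + 1 ≤ P.m + P.K) (U : GaugeField P j U1) {T δ σ : ℝ}
    (hInt : ∀ b : PBond P j, blkIter 1 b.src = blkIter 1 b.tgt → ‖toC (U b) - 1‖ ≤ T)
    (hTree : ∀ x : Balaban1983to89.Site P j, ‖holCK U 1 x - 1‖ ≤ δ)
    (hσ : 2 * (((P.L : ℝ) - 1) * P.L) * P.d * T ^ 2 + 2 * δ ^ 2 ≤ σ) (hΔ : Δ.IsHermitian) {γ E κ : ℝ} (hγ : 0 ≤ γ) (hκ : 0 ≤ κ)
    (hE : E < c240 P γ κ * (1 - σ))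
    (h238 : ∀ φ : Balaban1983to89.Site P j → ℂ, (∀ x ∉ Λ, φ x = 0) →
      γ * ∑ b : PBond P j, ‖toC (U b) * φ b.tgt - φ b.src‖ ^ 2 - E * ∑ x, ‖φ x‖ ^ 2 ≤ (star φ ⬝ᵥ (Δ *ᵥ φ)).re)
    {cΔ δ₀ : ℝ} (hcΔ : 0 ≤ cΔ) (hδ₀ : 0 < δ₀) (hker : ∀ x₁ ∈ Λ, ∀ x₂ ∈ Λ, ‖Δ x₁ x₂‖ ≤ cΔ * Real.exp (-(δ₀ * cdist x₁ x₂)))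
    {M : ℕ} (hM : 5 ≤ M)
    (hMR : kR P.d 2 (c240 P γ κ * (1 - σ) - E) (cΔ + κ * (((P.L : ℝ) ^ P.d)⁻¹) ^ 2 * Real.exp (δ₀ * ((P.L : ℝ) - 1))) δ₀ < M)
    (hMθ : thetaConst P.d 2 (c240 P γ κ * (1 - σ) - E) (cΔ + κ * (((P.L : ℝ) ^ P.d)⁻¹) ^ 2 * Real.exp (δ₀ * ((P.L : ℝ) - 1))) δ₀ < M)
    (hθW : thetaW P.d 2 (c240 P γ κ * (1 - σ) - E) (cΔ + κ * (((P.L : ℝ) ^ P.d)⁻¹) ^ 2 * Real.exp (δ₀ * ((P.L : ℝ) - 1))) δ₀ M < 1)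
    {s : ℕ} (hs : 0 < s)
    (hlarge : K0 P.d 2 (c240 P γ κ * (1 - σ) - E) (cΔ + κ * (((P.L : ℝ) ^ P.d)⁻¹) ^ 2 * Real.exp (δ₀ * ((P.L : ℝ) - 1))) δ₀ M ≤
      Real.exp (δ₀ / (128 * 9 ^ P.d) * s)) :
    BIJ88Sect2Statements.Ineq246 (fun X : Finset (Cubes M s (chartSet Λ)) => X.card)
      (fun (p : ↥Λ × Fin 2) (X : Finset (Cubes M s (chartSet Λ))) =>
        memX (fun (x : B4.Idx (chartSet Λ) 2) (l : ↥(labels M (chartSet Λ))) => InBox M l.1 (x.1 : Fin P.d → ℤ)) (cubeOf M s) touch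
          (idxEquiv Λ p) X)
      (fun X p q => cX (ldist (N := 2) M) ((s : ℝ) / 4) (cubeOf M s) touch
        (fun ω y₁ y₂ => latticeCw M (chartSet Λ) 2 (reOp Λ (op240 Δ κ U)) ω y₁ y₂) X (idxEquiv Λ p) (idxEquiv Λ q))
      (δ₀ / (128 * 9 ^ P.d)) s :=
  ineq246_walk (by linarith) (c56_nonneg P hκ hcΔ) hδ₀ (hyp56_op240_smallField hj U hInt hTree hσ hΔ hγ hκ h238 hδ₀.le hker)
    hM hMR hMθ hθW hs hlarge

/-- **(2.47) FOR THE MODEL'S `C^{(k)}_Λ(u)` AT A SMALL FIELD, AS THE TYPED ROW `BIJ88Sect2Statements.Close`** (*"|C^{(k)}_{Λ,loc}(u; x₁, x₂) −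
C^{(k)}_Λ(u; x₁, x₂)| ≦ e^{−cr(e_k)}e^{−c|x₁−x₂|}. (2.47)"*; two constants, site distance `|x₁ − x₂|_chart/M` in label units): with the data of
`eq242_smallField` and `θ_W(M) < 1`, `Close (|·−·|_chart/M) C^{(k)}_{Λ,loc} (realify C^{(k)}_Λ(u)) δ c`, `c = δ₀/16`,
`δ = 2^dγ₀^{−1}(1−θ_W)^{−1}e^{−(δ₀/16)(ρ−3)}` (print's `ρ = ¼r(e_k)`) — §5's `close247_walk` through §4. [cite: BalabanImbrieJaffe1988, (2.47) p.265] -/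
theorem close247_smallField (hj : j + 1 ≤ P.m + P.K) (U : GaugeField P j U1) {T δ σ : ℝ}
    (hInt : ∀ b : PBond P j, blkIter 1 b.src = blkIter 1 b.tgt → ‖toC (U b) - 1‖ ≤ T)
    (hTree : ∀ x : Balaban1983to89.Site P j, ‖holCK U 1 x - 1‖ ≤ δ)
    (hσ : 2 * (((P.L : ℝ) - 1) * P.L) * P.d * T ^ 2 + 2 * δ ^ 2 ≤ σ) (hΔ : Δ.IsHermitian) {γ E κ : ℝ} (hγ : 0 ≤ γ) (hκ : 0 ≤ κ)
    (hE : E < c240 P γ κ * (1 - σ))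
    (h238 : ∀ φ : Balaban1983to89.Site P j → ℂ, (∀ x ∉ Λ, φ x = 0) →
      γ * ∑ b : PBond P j, ‖toC (U b) * φ b.tgt - φ b.src‖ ^ 2 - E * ∑ x, ‖φ x‖ ^ 2 ≤ (star φ ⬝ᵥ (Δ *ᵥ φ)).re)
    {cΔ δ₀ : ℝ} (hcΔ : 0 ≤ cΔ) (hδ₀ : 0 < δ₀) (hker : ∀ x₁ ∈ Λ, ∀ x₂ ∈ Λ, ‖Δ x₁ x₂‖ ≤ cΔ * Real.exp (-(δ₀ * cdist x₁ x₂)))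
    {M : ℕ} (hM : 5 ≤ M)
    (hMR : kR P.d 2 (c240 P γ κ * (1 - σ) - E) (cΔ + κ * (((P.L : ℝ) ^ P.d)⁻¹) ^ 2 * Real.exp (δ₀ * ((P.L : ℝ) - 1))) δ₀ < M)
    (hMθ : thetaConst P.d 2 (c240 P γ κ * (1 - σ) - E) (cΔ + κ * (((P.L : ℝ) ^ P.d)⁻¹) ^ 2 * Real.exp (δ₀ * ((P.L : ℝ) - 1))) δ₀ < M)
    (hθW : thetaW P.d 2 (c240 P γ κ * (1 - σ) - E) (cΔ + κ * (((P.L : ℝ) ^ P.d)⁻¹) ^ 2 * Real.exp (δ₀ * ((P.L : ℝ) - 1))) δ₀ M < 1)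
    (ρ : ℝ) :
    BIJ88Sect2Statements.Close (fun p q : ↥Λ × Fin 2 => cdist p.1.1 q.1.1 / M)
      (fun p q => cLoc (ldist (N := 2) M) ρ (fun ω y₁ y₂ => latticeCw M (chartSet Λ) 2 (reOp Λ (op240 Δ κ U)) ω y₁ y₂)
        (idxEquiv Λ p) (idxEquiv Λ q))
      (fun p q => realify (compress Λ (op240 Δ κ U))⁻¹ p q)
      (2 ^ P.d * (c240 P γ κ * (1 - σ) - E)⁻¹ *
          (1 - thetaW P.d 2 (c240 P γ κ * (1 - σ) - E) (cΔ + κ * (((P.L : ℝ) ^ P.d)⁻¹) ^ 2 * Real.exp (δ₀ * ((P.L : ℝ) - 1))) δ₀ M)⁻¹ *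
        Real.exp (-(δ₀ / 16 * (ρ - 3))))
      (δ₀ / 16) :=
  close247_walk (by linarith) (c56_nonneg P hκ hcΔ) hδ₀ (hyp56_op240_smallField hj U hInt hTree hσ hΔ hγ hκ h238 hδ₀.le hker)
    (isUnit_compress_op240_smallField hj U hInt hTree hσ hγ hκ hE h238) hM hMR hMθ hθW ρ

end SmallField

end

end Literature.MathematicalPhysics.QuantumFieldTheory.BalabanImbrieJaffe1984to88.BIJ88Eq242HiggsCovarianceTorus
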